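import Summits.ABC.IUTFork.Joshi.ATS4RamificationDivisors
import Summits.ABC.IUTFork.Joshi.ATS4LocusUpperBounds

/-!
# Joshi, *Arithmetic Teichmüller Spaces IV* (arXiv:2403.10430v2) §6.7, Lemma 6.7.1 (1) ⟺ (3)/(4): an ERRATUM to the typing of
# `Joshi/ATS4RamificationDivisors.lean` (p430536), the repaired reading predicates «for a rational PRIME v_ℚ», a model, and the
# `s`-half of `LocusVolumeDatum.ComponentSums` discharged from the §6.7 definitions

Companion file of the abc-iut cell, branch E «type Joshi's construction, test vs S» (rung LADDER-ABC:A2.E; seat abc-iut-E-t31, slot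
T-31 = [J-IV] §6.6–§6.11; AUTHORS-FIRST erratum on the seat's own landed file, which stays byte-identical — DEFS-FREEZE). **No side is
taken** on [IUTchIII] Cor. 3.12, on Joshi's claims (unrefereed arXiv preprint) or on Mochizuki's report on them; typed ≠ proved ≠
endorsed; nothing of the paper is asserted. Render: `HOME/lit/renders/Joshi-arxiv-2403.10430/pNNNN.txt`, «p.N l.M» = line M of page N.

## The located defect (numbers, not adjectives)

Print, p.61 l.20–30: «For a rational prime v_ℚ and for L* ∈ {L_mod, ℚ}, write V_{L*,v_ℚ} = V_{L*} ×_{V_ℚ} {v_ℚ}. … Lemma 6.7.1. Under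
the notations and assumptions of Theorem 6.1.1, the following conditions are equivalent (1) v_ℚ ∈ V^dst_ℚ. (2) v_ℚ ramifies in L′.
(3) v_ℚ divides 30·ℓ or v_ℚ is in the image of Supp(q_{L_tpd} + d_{L_tpd}). (4) v_ℚ divides 30·ℓ or v_ℚ is in the image of
Supp(q_L + d_L).» The binder is a rational PRIME. The landed reading predicates `PrimeTowerDatum.Lem671₁₃` / `.Lem671₁₄` quantify
`∀ p : ℕ` over EVERY natural number. At `p = 1` their right-hand side holds (`1 ∣ 30·ℓ`), so each forces `1 ∈ V^dst_ℚ`, i.e. a prime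
of `L_mod` of residue characteristic `1` (`one_mem_vdstQ_of_lem671₁₃`): both predicates are UNSATISFIABLE at every datum whose
residue characteristics are `≠ 1` — in particular at every datum with prime residue characteristics, which is every faithful
instantiation (`not_lem671₁₃_of_prime`, `not_lem671₁₄_of_prime`). STRONGER-THAN-PRINT; no consumer in the tree (the E5 spine
`MainBoundGlue.thm611_left_of_inputs` never takes them). The other four [A]-side predicates (`Lem661₁₂`, `Lem661₁₃`, `Eq6106`,
`Lem6105`) quantify over primes of `M` and are unaffected.

## What this file adds

1. The kernel certificate of the defect (§1).
2. The REPAIRED reading predicates `Lem671₁₃'`, `Lem671₁₄'` — the same displays under the printed binder `p` prime (§2); the landed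
   ones imply them (`lem671₁₃'_of`), so nothing typed against the old names is lost.
3. §6.7 ⟹ half of `LocusVolumeDatum.ComponentSums` (file [B] = `Joshi/ATS4LocusUpperBounds.lean` p430311, OUR READING «log(s_ℚ),
   log(s^≤_ℚ) are the sums of their v_ℚ-components over V^dst_ℚ»): when [B]'s `V^dst_ℚ`, `log(s_ℚ)`, `log(s^≤_ℚ)` and their components
   ARE the §6.7 objects of [A] (`TowerGlue`), the two `s`-conjuncts hold BY DEFINITION ((6.7.2)/(6.7.4)/(6.7.6)/(6.7.7), (6.8.12)
   p.64 l.4–13) — `ComponentSums` reduces to its `d_{L′}`- and `q`-conjuncts (`TowerGlue.componentSums_iff`) (§3).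
4. A MODEL (§4): the tower read at the level of rational primes (every prime type := the rational primes `Nat.Primes`, all
   restrictions the identity, residue characteristic = the prime itself, `L′` ramified exactly above the primes dividing `30·ℓ`,
   `ℓ = 5`, empty `Supp(q + d)`, all `e = f = 1`, `d_mod = 1`, `e*_mod = 2¹²·3³·5`). There `Lem661₁₂ ∧ Lem661₁₃ ∧ Lem671₁₃' ∧ Lem671₁₄' ∧
   Eq6106 ∧ Lem6105` hold (`primesTower_readings`: the repaired [A]-side predicates are JOINTLY SATISFIABLE with prime residue
   characteristics) while `¬ Lem671₁₃ ∧ ¬ Lem671₁₄` (`primesTower_not_lem671`): the repair is not cosmetic. A model exhibits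
   satisfiability of reading predicates over the typed SIGNATURE, nothing of the arithmetic of any curve.

[claim: Joshi2024ATS4, status: disputed] (locators, the two repaired predicates); the theorems are [folklore].
-/

noncomputable section

open Finset

namespace Summit.ABC.IUTFork.Joshi.ATS4

namespace PrimeTowerDatum

variable (T : PrimeTowerDatum)

/-! ## 1. The erratum in the kernel -/

/-- `V^dst_ℚ` membership unfolded: `p ∈ V^dst_ℚ` iff some prime of `L_mod` in `V^dst_{L_mod}` has residue characteristic `p`.
[folklore] -/
theorem mem_vdstQ_iff (p : ℕ) : p ∈ T.VdstQ ↔ ∃ v ∈ T.VdstMod, T.char v = p := Iff.rfl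

/-- `Lem671₁₃` AS TYPED forces `1 ∈ V^dst_ℚ` (instantiate its `∀ p : ℕ` at `p = 1`: `1 ∣ 30·ℓ`). [folklore] -/
theorem one_mem_vdstQ_of_lem671₁₃ (h : T.Lem671₁₃) : 1 ∈ T.VdstQ := (h 1).2 (Or.inl (one_dvd _))

/-- `Lem671₁₄` AS TYPED forces `1 ∈ V^dst_ℚ`. [folklore] -/
theorem one_mem_vdstQ_of_lem671₁₄ (h : T.Lem671₁₄) : 1 ∈ T.VdstQ := (h 1).2 (Or.inl (one_dvd _))

/-- No residue characteristic is `1` ⟹ `1 ∉ V^dst_ℚ`. [folklore] -/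
theorem one_notMem_vdstQ (h : ∀ v : T.Pmod, T.char v ≠ 1) : 1 ∉ T.VdstQ := by
  rintro ⟨v, -, hv⟩
  exact h v hv

/-- **`Lem671₁₃` as typed is unsatisfiable** at every datum whose residue characteristics are `≠ 1`. [folklore] -/
theorem not_lem671₁₃ (h : ∀ v : T.Pmod, T.char v ≠ 1) : ¬ T.Lem671₁₃ :=
  fun h' => T.one_notMem_vdstQ h (T.one_mem_vdstQ_of_lem671₁₃ h')

/-- **`Lem671₁₄` as typed is unsatisfiable** at every datum whose residue characteristics are `≠ 1`. [folklore] -/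
theorem not_lem671₁₄ (h : ∀ v : T.Pmod, T.char v ≠ 1) : ¬ T.Lem671₁₄ :=
  fun h' => T.one_notMem_vdstQ h (T.one_mem_vdstQ_of_lem671₁₄ h')

/-- In particular at every datum with PRIME residue characteristics (every faithful instantiation: `p_v` is the characteristic of
the residue field of `v`, p.65 l.31). [folklore] -/
theorem not_lem671₁₃_of_prime (h : ∀ v : T.Pmod, (T.char v).Prime) : ¬ T.Lem671₁₃ :=
  T.not_lem671₁₃ fun v => (h v).ne_one

/-- The same for `Lem671₁₄`. [folklore] -/
theorem not_lem671₁₄_of_prime (h : ∀ v : T.Pmod, (T.char v).Prime) : ¬ T.Lem671₁₄ :=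
  T.not_lem671₁₄ fun v => (h v).ne_one

/-- With prime residue characteristics, `V^dst_ℚ` consists of primes (so a predicate binding `p ∈ V^dst_ℚ` only ever speaks about
primes — the repair below changes nothing on the `(1) ⟹` side). [folklore] -/
theorem prime_of_mem_vdstQ (h : ∀ v : T.Pmod, (T.char v).Prime) {p : ℕ} (hp : p ∈ T.VdstQ) : p.Prime := by
  obtain ⟨v, -, rfl⟩ := hp
  exact h v

/-! ## 2. The repaired reading predicates: Lemma 6.7.1 (1) ⟺ (3), (1) ⟺ (4) «for a rational prime v_ℚ» -/

/-- **Lemma 6.7.1 (1) ⟺ (3), AS PRINTED** (p.61 l.20 «For a rational prime v_ℚ»; l.26–29): for every rational PRIME `p`, «p ∈ V^dst_ℚ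
⟺ p divides 30·ℓ or p is in the image of Supp(q_{L_tpd} + d_{L_tpd})». READING PREDICATE; never asserted. Repairs `Lem671₁₃`
(p430536), whose binder ranges over all naturals. [claim: Joshi2024ATS4, status: disputed] -/
@[claim "Joshi2024ATS4" "disputed"]
def Lem671₁₃' : Prop := ∀ p : ℕ, p.Prime → (p ∈ T.VdstQ ↔ (p ∣ 30 * T.l ∨ p ∈ T.charTpd '' T.suppTpd))

/-- **Lemma 6.7.1 (1) ⟺ (4), AS PRINTED** (p.61 l.20, l.26–30): for every rational PRIME `p`, «p ∈ V^dst_ℚ ⟺ p divides 30·ℓ or p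
is in the image of Supp(q_L + d_L)». READING PREDICATE; never asserted. Repairs `Lem671₁₄` (p430536).
[claim: Joshi2024ATS4, status: disputed] -/
@[claim "Joshi2024ATS4" "disputed"]
def Lem671₁₄' : Prop := ∀ p : ℕ, p.Prime → (p ∈ T.VdstQ ↔ (p ∣ 30 * T.l ∨ p ∈ T.charL '' T.suppL))

/-- The landed predicate implies the repaired one (restriction of the binder). [folklore] -/
theorem lem671₁₃'_of (h : T.Lem671₁₃) : T.Lem671₁₃' := fun p _ => h p

/-- The landed predicate implies the repaired one (restriction of the binder). [folklore] -/
theorem lem671₁₄'_of (h : T.Lem671₁₄) : T.Lem671₁₄' := fun p _ => h p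

/-- Under the repaired Lemma 6.7.1 (1) ⟺ (3) and prime residue characteristics, `V^dst_ℚ` is EXACTLY the set of primes dividing
`30·ℓ` or lying below `Supp(q_{L_tpd} + d_{L_tpd})` — the form in which §6.8 ((6.8.12)–(6.8.16), p.64 l.4–42) uses the lemma.
[claim: Joshi2024ATS4, status: disputed] -/
theorem vdstQ_eq_of_lem671₁₃' (hc : ∀ v : T.Pmod, (T.char v).Prime) (h : T.Lem671₁₃') :
    T.VdstQ = {p | p.Prime ∧ (p ∣ 30 * T.l ∨ p ∈ T.charTpd '' T.suppTpd)} := by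
  ext p
  refine ⟨fun hp => ?_, fun hp => (h p hp.1).2 hp.2⟩
  have hpp := T.prime_of_mem_vdstQ hc hp
  exact ⟨hpp, (h p hpp).1 hp⟩

/-! ## 3. §6.7 ⟹ the `s`-half of [B]'s `ComponentSums` -/

/-- **The identifications between [A]'s §6.7 objects and [B]'s free reals** (OUR READING; «the same quantity printed in two places»):
[B]'s `ℓ`, `V^dst_ℚ` (a `Finset ℕ`), `log(s_ℚ)`, `log(s^≤_ℚ)` and their `v_ℚ`-components are [A]'s `ℓ`, `vdstQFinset`, `logSQ` ((6.7.4)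
for `L* = ℚ`), `logSleQ` ((6.7.7)), `logSQAt`, `logSleQAt`. Never asserted. [claim: Joshi2024ATS4, status: disputed] -/
structure TowerGlue (T : PrimeTowerDatum) (d : LocusVolumeDatum) : Prop where
  /-- `ℓ` -/ l_eq : d.l = T.l
  /-- `V^dst_ℚ` -/ vdst_eq : d.Vdst = T.vdstQFinset
  /-- `log(s_ℚ)` -/ logsQ_eq : d.logsQ = T.logSQ
  /-- `log(s^≤_ℚ)` -/ logsLe_eq : d.logsLe = T.logSleQ
  /-- `log(s_{ℚ,v_ℚ})` -/ logsQAt_eq : ∀ p, d.logsQAt p = logSQAt p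
  /-- `log(s^≤_{v_ℚ})` -/ logsLeAt_eq : ∀ p, d.logsLeAt p = T.logSleQAt p

namespace TowerGlue

variable {T} {d : LocusVolumeDatum} (G : TowerGlue T d)
include G

/-- `Σ_{p ∈ V^dst_ℚ} log(s_{ℚ,p}) = log(s_ℚ)` — by (6.7.2)/(6.7.4) for `L* = ℚ` ((6.8.12) p.64 l.4–13), i.e. by [A]'s DEFINITION of
`logSQ`. PROVED. [claim: Joshi2024ATS4, status: disputed] -/
theorem sum_logsQAt : ∑ p ∈ d.Vdst, d.logsQAt p = d.logsQ := by
  rw [G.vdst_eq, G.logsQ_eq]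
  simp only [G.logsQAt_eq]
  rfl

/-- `Σ_{p ∈ V^dst_ℚ} log(s^≤_p) = log(s^≤_ℚ)` — by (6.7.6)/(6.7.7) for `L* = ℚ`, i.e. by [A]'s DEFINITION of `logSleQ`. PROVED.
[claim: Joshi2024ATS4, status: disputed] -/
theorem sum_logsLeAt : ∑ p ∈ d.Vdst, d.logsLeAt p = d.logsLe := by
  rw [G.vdst_eq, G.logsLe_eq]
  simp only [G.logsLeAt_eq]
  rfl

/-- **[B]'s `ComponentSums` reduces to its `d_{L′}`- and `q`-conjuncts** once the `s`-objects are [A]'s. PROVED.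
[claim: Joshi2024ATS4, status: disputed] -/
theorem componentSums_iff :
    d.ComponentSums ↔ (∑ p ∈ d.Vdst, d.logDiffLpAt p = d.logDiffLp ∧ ∑ p ∈ d.Vdst, d.logqAt p = d.logq) := by
  unfold LocusVolumeDatum.ComponentSums
  exact ⟨fun h => ⟨h.1, h.2.1⟩, fun h => ⟨h.1, h.2, G.sum_logsQAt, G.sum_logsLeAt⟩⟩

/-- `log(s^≤_ℚ) ≤ log(s_ℚ)` transported to [B] (from [A]'s PROVED `logSleQ_le_logSQ`). [folklore] -/
theorem logsLe_le_logsQ : d.logsLe ≤ d.logsQ := by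
  rw [G.logsLe_eq, G.logsQ_eq]; exact T.logSleQ_le_logSQ

/-- `0 ≤ log(s^≤_ℚ)` and `0 ≤ log(s_ℚ)` transported to [B] (from [A]'s PROVED `degrees_nonneg`). [folklore] -/
theorem logs_nonneg : 0 ≤ d.logsLe ∧ 0 ≤ d.logsQ := by
  rw [G.logsLe_eq, G.logsQ_eq]; exact ⟨T.degrees_nonneg.2.2.2.1, T.degrees_nonneg.2.2.1⟩

end TowerGlue

end PrimeTowerDatum

/-! ## 4. A model with prime residue characteristics -/

/-- **The tower read at the level of rational primes**: every prime type is `Nat.Primes`, every restriction map the identity, the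
residue characteristic of a prime is the prime itself, `L′` is ramified exactly above the primes dividing `30·ℓ` with `ℓ = 5`,
`Supp(q + d) = ∅` at every level, `e = f = 1` throughout, `d_mod = 1`, `e*_mod = 2¹²·3³·5`. A model of the SIGNATURE of
`PrimeTowerDatum`, nothing more. [folklore] -/
def primesTower : PrimeTowerDatum where
  W := Nat.Primes
  PM := Nat.Primes
  PL := Nat.Primes
  Ptpd := Nat.Primes
  Pmod := Nat.Primes
  resM := id
  resL := id
  MtoTpd := id
  LtoTpd := id
  tpdToMod := id
  res_comm := fun _ => rfl
  char := Subtype.val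
  Ramified := Subtype.val ⁻¹' {n : ℕ | n ∣ 30 * 5}
  ramified_finite :=
    ((Set.finite_Iic (30 * 5)).subset fun n (hn : n ∣ 30 * 5) => Nat.le_of_dvd (by norm_num) hn).preimage
      Subtype.val_injective.injOn
  suppM := ∅
  suppTpd := ∅
  suppL := ∅
  eM := fun _ => 1
  eMod := fun _ => 1
  fMod := fun _ => 1
  dmod := 1
  estar := 2 ^ 12 * 3 ^ 3 * 5
  l := 5

namespace primesTower

/-- Residue characteristics of the model are prime. [folklore] -/
theorem char_prime : ∀ v : primesTower.Pmod, (primesTower.char v).Prime := fun v => v.2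

/-- `V^dst` at any level of the model along the identity is the ramified set. [folklore] -/
theorem vdst_id : primesTower.vdst (id : Nat.Primes → Nat.Primes) = primesTower.Ramified := Set.image_id _

/-- Membership in the model's ramified set: `↑w ∣ 150`. [folklore] -/
theorem mem_ramified (w : Nat.Primes) : w ∈ primesTower.Ramified ↔ (w : ℕ) ∣ 30 * 5 := Iff.rfl

/-- `V^dst_M` of the model is the ramified set. [folklore] -/
theorem vdstM_eq : primesTower.VdstM = primesTower.Ramified := vdst_id

/-- `V^dst_{L_tpd}` of the model is the ramified set. [folklore] -/
theorem vdstTpd_eq : primesTower.VdstTpd = primesTower.Ramified := vdst_id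

/-- The model's `Supp(q_M + d_M)` is empty (by definition). [folklore] -/
theorem suppM_eq : primesTower.suppM = ∅ := rfl

/-- The model's `Supp(q_{L_tpd} + d_{L_tpd})` is empty (by definition). [folklore] -/
theorem suppTpd_eq : primesTower.suppTpd = ∅ := rfl

/-- The model's `Supp(q_L + d_L)` is empty (by definition). [folklore] -/
theorem suppL_eq : primesTower.suppL = ∅ := rfl

/-- The model's `ℓ` is `5` (by definition). [folklore] -/
theorem l_eq : primesTower.l = 5 := rfl

/-- `V^dst_ℚ` of the model: the primes dividing `150`. [folklore] -/
theorem mem_vdstQ (p : ℕ) : p ∈ primesTower.VdstQ ↔ p.Prime ∧ p ∣ 30 * 5 := by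
  rw [primesTower.vdstQ_eq]
  change p ∈ Subtype.val '' primesTower.Ramified ↔ _
  constructor
  · rintro ⟨w, hw, rfl⟩
    exact ⟨w.2, hw⟩
  · rintro ⟨hp, hd⟩
    exact ⟨⟨p, hp⟩, hd, rfl⟩

/-- **The repaired [A]-side reading predicates are jointly satisfiable with prime residue characteristics**: at the model,
Lemma 6.6.1 (1) ⟺ (2), (1) ⟺ (3), Lemma 6.7.1 (1) ⟺ (3), (1) ⟺ (4) (repaired), (6.10.6) and Lemma 6.10.5 (the last BY THE PROVED step
`lem6105_of_eq6106`) all hold. [folklore] -/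
theorem readings :
    primesTower.Lem661₁₂ ∧ primesTower.Lem661₁₃ ∧ primesTower.Lem671₁₃' ∧ primesTower.Lem671₁₄' ∧ primesTower.Eq6106 ∧
      primesTower.Lem6105 := by
  have h6 : primesTower.Eq6106 := by
    intro u
    change ((1 : ℕ) : ℝ) ≤ ((2 ^ 12 * 3 ^ 3 * 5 : ℕ) : ℝ) * ((5 : ℕ) : ℝ) ^ 4
    norm_num
  refine ⟨fun v => ?_, fun v => ?_, fun p hp => ?_, fun p hp => ?_, h6, ?_⟩
  · -- Lemma 6.6.1 (1) ⟺ (2): `v ∈ V^dst_M ⟺ p_v ∣ 30·ℓ ∨ v ∈ ∅`, both sides read `↑v ∣ 150`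
    rw [vdstM_eq]
    exact ⟨fun h => Or.inl h, fun h => h.elim id fun h' => (Set.notMem_empty v h').elim⟩
  · -- Lemma 6.6.1 (1) ⟺ (3): both sides are membership in the ramified set
    rw [vdstM_eq, vdstTpd_eq]
    exact Iff.rfl
  · -- Lemma 6.7.1 (1) ⟺ (3), repaired binder
    rw [mem_vdstQ, suppTpd_eq, Set.image_empty, l_eq]
    simp [hp]
  · -- Lemma 6.7.1 (1) ⟺ (4), repaired binder
    rw [mem_vdstQ, suppL_eq, Set.image_empty, l_eq]
    simp [hp]
  · exact primesTower.lem6105_of_eq6106 (by change 3 ≤ 2 ^ 12 * 3 ^ 3 * 5; norm_num) (by change 1 ≤ 5; norm_num) h6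

/-- **… while the landed `Lem671₁₃`, `Lem671₁₄` (binder `∀ p : ℕ`) FAIL there** — the repair is not cosmetic. [folklore] -/
theorem not_lem671 : ¬ primesTower.Lem671₁₃ ∧ ¬ primesTower.Lem671₁₄ :=
  ⟨primesTower.not_lem671₁₃_of_prime char_prime, primesTower.not_lem671₁₄_of_prime char_prime⟩

/-- At the model `V^dst_ℚ = {2, 3, 5}` as a predicate: the primes dividing `150 = 2·3·5²`. [folklore] -/
theorem mem_vdstQ_iff (p : ℕ) : p ∈ primesTower.VdstQ ↔ (p = 2 ∨ p = 3 ∨ p = 5) := by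
  rw [mem_vdstQ]
  constructor
  · rintro ⟨hp, hd⟩
    have h150 : (30 * 5 : ℕ) = 2 * (3 * (5 * 5)) := by norm_num
    rw [h150] at hd
    rcases hp.dvd_mul.1 hd with h | h
    · exact Or.inl ((Nat.prime_dvd_prime_iff_eq hp Nat.prime_two).1 h)
    rcases hp.dvd_mul.1 h with h | h
    · exact Or.inr (Or.inl ((Nat.prime_dvd_prime_iff_eq hp Nat.prime_three).1 h))
    rcases hp.dvd_mul.1 h with h | h <;>
      exact Or.inr (Or.inr ((Nat.prime_dvd_prime_iff_eq hp Nat.prime_five).1 h))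
  · rintro (rfl | rfl | rfl)
    · exact ⟨Nat.prime_two, by norm_num⟩
    · exact ⟨Nat.prime_three, by norm_num⟩
    · exact ⟨Nat.prime_five, by norm_num⟩

end primesTower

end Summit.ABC.IUTFork.Joshi.ATS4

end
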